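import Literature.NumberTheory.LFunctions.ConreyIwaniec2002CircleMethodDefs
import Literature.NumberTheory.LFunctions.KloostermanIncompleteInterval
import HarnessLib

/-!
# Conrey–Iwaniec (2002), §4 (4.14): incomplete Kloosterman sums with a linear and an inverse phase over an interval

B. Conrey, H. Iwaniec, *Spacing of zeros of Hecke `L`-functions and the class number problem*,
Acta Arith. 103 (2002), §4 (4.13)–(4.14) [held text `paper:arxiv-math_0111012`, p0011:L8–27]:
"Splitting into residue classes … we obtain incomplete Kloostermann sums for which Weil's bound
yields `Σ*_{d∈I} e((dl − ah)/c) ≪ (h,c)^{1/2}c^{1/2}τ(c)log C` (4.14)" (`a = d̄`, `I` an interval of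
length `≤ c` (4.13)). Registered stub S3b2 `stub_incomplete_kloosterman` of SKELETON S3 (cell
`landau-siegel/ls-inputs`, line `theta-circle-method`), PROVED with `K₀ = 2`:
`incompleteKloostermanBound_two : IncompleteKloostermanBound 2` and
`incomplete_kloosterman : ∃ K₀ > 0, IncompleteKloostermanBound K₀` (statement verbatim).

Proof = completion, exactly as the tree's `KI_sum_progression_le` (Bettin–Chandee, Appendix
Lemma 1; DFI 1997 Lemma 8) with the linear phase added: `G(u) = [u unit]·e_c(lu + hu⁻¹)` on `ℤ/cℤ`
has finite Fourier transform `Ĝ(t) = S(l − t, h; c)` (a Kloosterman sum), so by Weil's bound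
(the tree's PROVED `weil_kloosterman_bound_holds`) `|Ĝ(t)| ≤ τ(c)√c√(h,c)` for every `t`;
`G(d) = c⁻¹Σ_t Ĝ(t)e_c(td)` and `Σ_{d∈I}e_c(td)` is a geometric sum, `≤ |I| ≤ c` for `t = 0` and
`≤ 1/(2‖t/c‖)` otherwise, with `Σ_{t≠0} 1/(2‖t/c‖) ≤ c(1 + log c)`
(`KI_sum_inv_distInt_le`). Total: `τ(c)√c√(h,c)·(1 + 1 + log c) ≤ 2τ(c)√(h,c)√c(1 + log c)`.

## References

* [ConreyIwaniec2002] B. Conrey, H. Iwaniec, Acta Arith. 103 (2002) 259–312, arXiv:math/0111012: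
  §4 (4.13)–(4.14).
* [BettinChandee2018] S. Bettin, V. Chandee, Adv. Math. 328 (2018), Appendix Lemma 1 (completion).
* [Iwaniec2002] H. Iwaniec, *Spectral Methods of Automorphic Forms*, §2.5 (2.25) (Weil's bound).
-/

noncomputable section

open Finset
open scoped FourierTransform

namespace Literature.NumberTheory.LFunctions

namespace ConreyIwaniec2002

open Literature.NumberTheory.Sieve.Iwaniec1978 (hooley_gcd_eq_one_iff_isUnit
  hooley_fourier_inversion hooley_norm_kloostermanSum_le hooley_norm_sum_range_fourierChar_le
  hooley_separated)
open Literature.NumberTheory.Sieve.Vinogradov (distInt geomBound distInt_nonneg geomBound_nonneg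
  geomBound_le geomBound_le_inv)

/-- The summand of (4.14) through the standard additive character of `ℤ/cℤ`:
`e((l d + h d̄)/c) = e_c(l·d + h·d⁻¹)` for `(d, c) = 1`. [folklore] -/
private theorem term_eq_stdAddChar {c : ℕ} [NeZero c] (l h d : ℤ) :
    (𝐞 (((l * d + h * (((d : ZMod c)⁻¹).val : ℤ) : ℤ) : ℝ) / c) : ℂ) =
      (ZMod.stdAddChar ((l : ZMod c) * (d : ZMod c) + (h : ZMod c) * (d : ZMod c)⁻¹) : ℂ) := by
  have hc : (l : ZMod c) * (d : ZMod c) + (h : ZMod c) * (d : ZMod c)⁻¹ =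
      (((l * d + h * (((d : ZMod c)⁻¹).val : ℤ) : ℤ)) : ZMod c) := by
    push_cast
    rw [ZMod.natCast_zmod_val]
  rw [hc, ZMod.stdAddChar_coe, Real.fourierChar_apply]
  congr 1
  push_cast
  ring

/-- The finite Fourier transform of `u ↦ [u unit] e_c(lu + hu⁻¹)` is a Kloosterman sum:
`Σ_u [u unit] e_c(lu + hu⁻¹) e_c(−tu) = S(−(t − l), h; c)`. [folklore] -/
private theorem transform_eq_kloostermanSum {c : ℕ} [NeZero c] (ll hh t : ZMod c) :
    ∑ u : ZMod c, (if IsUnit u then (ZMod.stdAddChar (ll * u + hh * u⁻¹) : ℂ) else 0) *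
        (ZMod.stdAddChar (-(t * u)) : ℂ) = kloostermanSum c (-(t - ll)) hh := by
  classical
  unfold kloostermanSum
  refine Finset.sum_congr rfl fun u _ => ?_
  split_ifs with hu
  · rw [← AddChar.map_add_eq_mul,
      show ll * u + hh * u⁻¹ + -(t * u) = -(t - ll) * u + hh * u⁻¹ by ring]
  · rw [zero_mul]

/-- **(4.14) with the constant `2`**: `IncompleteKloostermanBound 2`. [cite: ConreyIwaniec2002, §4 (4.14)] -/
theorem incompleteKloostermanBound_two : IncompleteKloostermanBound 2 := by
  intro c hc l h y₁ y₂ hy hlen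
  classical
  haveI : NeZero c := ⟨by omega⟩
  have hc0 : 0 < c := by omega
  have hcR : (0 : ℝ) < c := by exact_mod_cast hc0
  have hcC : (c : ℂ) ≠ 0 := Nat.cast_ne_zero.mpr hc0.ne'
  -- notation
  set ψ : AddChar (ZMod c) ℂ := ZMod.stdAddChar with hψ
  set G : ZMod c → ℂ := fun u =>
    if IsUnit u then (ψ ((l : ZMod c) * u + (h : ZMod c) * u⁻¹) : ℂ) else 0 with hG
  set Gh : ZMod c → ℂ := fun t => ∑ u : ZMod c, G u * (ψ (-(t * u)) : ℂ) with hGh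
  set B : ℝ := (Nat.divisors c).card * Real.sqrt c * Real.sqrt (Int.gcd h c) with hB
  have hB0 : 0 ≤ B := by positivity
  -- Weil for every frequency
  have hGh_le : ∀ t, ‖Gh t‖ ≤ B := by
    intro t
    have h1 : Gh t = kloostermanSum c (-(t - (l : ZMod c))) (h : ZMod c) := by
      rw [hGh]
      exact transform_eq_kloostermanSum (l : ZMod c) (h : ZMod c) t
    rw [h1]
    exact hooley_norm_kloostermanSum_le weil_kloosterman_bound_holds _ h
  -- the run `y₁ < d ≤ y₂` as `y₁ + 1 + n`, `n < K`
  obtain ⟨K, hK⟩ : ∃ K : ℕ, (K : ℤ) = y₂ - y₁ := ⟨(y₂ - y₁).toNat, by omega⟩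
  have hKc : (K : ℝ) ≤ c := by
    have : (K : ℤ) ≤ c := by omega
    exact_mod_cast this
  set rr : ℕ → ℤ := fun n => y₁ + 1 + (n : ℤ) with hrr
  have hIoc : Finset.Ioc y₁ y₂ = (Finset.range K).map ⟨rr, fun i j hij => by
      simp only [hrr] at hij; exact_mod_cast (add_left_cancel hij)⟩ := by
    ext m
    simp only [Finset.mem_Ioc, Finset.mem_map, Finset.mem_range, Function.Embedding.coeFn_mk, hrr]
    constructor
    · rintro ⟨h1, h2⟩
      refine ⟨(m - y₁ - 1).toNat, ?_, ?_⟩ <;> omega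
    · rintro ⟨n, hn, rfl⟩; omega
  -- Step 1: the summand through `G`
  have hstep1 : ∀ d : ℤ,
      (if Int.gcd d c = 1 then
        (𝐞 (((l * d + h * (((d : ZMod c)⁻¹).val : ℤ) : ℤ) : ℝ) / c) : ℂ) else 0) =
      G (d : ZMod c) := by
    intro d
    by_cases hg : Int.gcd d c = 1
    · rw [if_pos hg, term_eq_stdAddChar]
      simp only [hG, hψ]
      rw [if_pos ((hooley_gcd_eq_one_iff_isUnit _).mp hg)]
    · rw [if_neg hg]
      simp only [hG]
      rw [if_neg (fun hu => hg ((hooley_gcd_eq_one_iff_isUnit _).mpr hu))]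
  -- Step 2: Fourier inversion `G(w) = c⁻¹ ∑_t Ĝ(t) e_c(t w)`
  have hGinv : ∀ w : ZMod c, G w = (c : ℂ)⁻¹ * ∑ t : ZMod c, Gh t * (ψ (t * w) : ℂ) := by
    intro w
    have hinv := hooley_fourier_inversion G w
    rw [hGh, hψ, hinv, ← mul_assoc, inv_mul_cancel₀ hcC, one_mul]
  -- the geometric sums `T(w) = ∑_d e_c(w d)`
  set T : ZMod c → ℂ := fun w => ∑ n ∈ Finset.range K, (ψ (w * (rr n : ZMod c)) : ℂ) with hT
  have hT_le : ∀ w : ZMod c, ‖T w‖ ≤ geomBound K (((w.val : ℕ) : ℝ) / c) := by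
    intro w
    rw [hT]
    simp only
    simp_rw [hψ, KI_stdAddChar_mul_intCast]
    exact hooley_norm_sum_range_fourierChar_le y₁ _ le_rfl
  have hT0' : T 0 = K := by
    rw [hT]
    show ∑ n ∈ Finset.range K, ((ψ (0 * (rr n : ZMod c)) : ℂ)) = K
    rw [Finset.sum_congr rfl (fun n _ => by rw [zero_mul, AddChar.map_zero_eq_one]),
      Finset.sum_const, Finset.card_range, Nat.smul_one_eq_cast]
  have hT0 : ‖T 0‖ ≤ c := by
    rw [hT0', Complex.norm_natCast]
    exact hKc
  -- Step 3: the sum equals `c⁻¹ ∑_t Ĝ(t) T(t)`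
  have hS_eq : ∑ d ∈ (Finset.Ioc y₁ y₂).filter (fun d : ℤ ↦ Int.gcd d c = 1),
      (𝐞 (((l * d + h * (((d : ZMod c)⁻¹).val : ℤ) : ℤ) : ℝ) / c) : ℂ) =
      (c : ℂ)⁻¹ * ∑ t : ZMod c, Gh t * T t := by
    rw [Finset.sum_filter, hIoc, Finset.sum_map]
    simp only [Function.Embedding.coeFn_mk]
    simp_rw [hstep1, hGinv, ← Finset.mul_sum]
    congr 1
    rw [Finset.sum_comm]
    refine Finset.sum_congr rfl fun t _ => ?_
    rw [hT]
    simp only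
    rw [Finset.mul_sum]
  -- Step 4: split off `t = 0` and bound
  rw [hS_eq, ← Finset.add_sum_erase _ _ (Finset.mem_univ (0 : ZMod c)), mul_add]
  have hsum : ‖∑ t ∈ (Finset.univ : Finset (ZMod c)).erase 0, Gh t * T t‖ ≤
      B * (c * (1 + Real.log c)) := by
    calc ‖∑ t ∈ (Finset.univ : Finset (ZMod c)).erase 0, Gh t * T t‖
        ≤ ∑ t ∈ (Finset.univ : Finset (ZMod c)).erase 0, ‖Gh t * T t‖ := norm_sum_le _ _
      _ ≤ ∑ t ∈ (Finset.univ : Finset (ZMod c)).erase 0,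
          B * geomBound K (((t.val : ℕ) : ℝ) / c) := by
          refine Finset.sum_le_sum fun t _ => ?_
          rw [norm_mul]
          exact mul_le_mul (hGh_le t) (hT_le t) (norm_nonneg _) hB0
      _ = B * ∑ w ∈ (Finset.univ : Finset (ZMod c)).erase 0,
          geomBound K ((((w.val : ℕ) : ℝ)) / c) := by rw [← Finset.mul_sum]
      _ ≤ B * ∑ w ∈ (Finset.univ : Finset (ZMod c)).erase 0,
          1 / (2 * distInt ((((w.val : ℕ) : ℝ)) / c)) := by
          refine mul_le_mul_of_nonneg_left (Finset.sum_le_sum fun w hw => ?_) hB0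
          refine geomBound_le_inv _ ?_
          have hw0 : w ≠ 0 := Finset.ne_of_mem_erase hw
          have hv : w.val ≠ 0 := fun h => hw0 ((ZMod.val_eq_zero w).mp h)
          have := hooley_separated hc0 (0 : ℝ) w.val (Finset.mem_range.mpr (ZMod.val_lt w)) 0
            (Finset.mem_range.mpr hc0) hv
          have h1 : 1 / (c : ℝ) ≤ distInt (((w.val : ℕ) : ℝ) / c) := by simpa using this
          exact lt_of_lt_of_le (by positivity) h1
      _ ≤ B * (c * (1 + Real.log c)) :=
          mul_le_mul_of_nonneg_left (KI_sum_inv_distInt_le c) hB0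
  have hlog : 0 ≤ Real.log c := Real.log_nonneg (by exact_mod_cast hc)
  have hA : ‖(c : ℂ)⁻¹ * (Gh 0 * T 0)‖ ≤ (c : ℝ)⁻¹ * (B * c) := by
    rw [norm_mul, norm_inv, Complex.norm_natCast, norm_mul]
    exact mul_le_mul_of_nonneg_left (mul_le_mul (hGh_le 0) hT0 (norm_nonneg _) hB0)
      (by positivity)
  have hB' : ‖(c : ℂ)⁻¹ * ∑ t ∈ (Finset.univ : Finset (ZMod c)).erase 0, Gh t * T t‖ ≤
      (c : ℝ)⁻¹ * (B * (c * (1 + Real.log c))) := by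
    rw [norm_mul, norm_inv, Complex.norm_natCast]
    exact mul_le_mul_of_nonneg_left hsum (by positivity)
  refine (norm_add_le _ _).trans ?_
  calc ‖(c : ℂ)⁻¹ * (Gh 0 * T 0)‖ + ‖(c : ℂ)⁻¹ * ∑ t ∈ (Finset.univ : Finset (ZMod c)).erase 0, Gh t * T t‖
      ≤ (c : ℝ)⁻¹ * (B * c) + (c : ℝ)⁻¹ * (B * (c * (1 + Real.log c))) := add_le_add hA hB'
    _ = B * ((c : ℝ)⁻¹ * c) + B * ((c : ℝ)⁻¹ * c) * (1 + Real.log c) := by ring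
    _ = B * (1 + (1 + Real.log c)) := by rw [inv_mul_cancel₀ hcR.ne']; ring
    _ ≤ B * (2 * (1 + Real.log c)) := by
        refine mul_le_mul_of_nonneg_left ?_ hB0
        linarith
    _ = 2 * (Nat.divisors c).card * Real.sqrt (Int.gcd h c) * Real.sqrt c * (1 + Real.log c) := by
        rw [hB]; ring

/-- **S3b2 — (4.14)** (registered sub-stub `stub_incomplete_kloosterman` of SKELETON S3, statement
verbatim): `∃ K₀ > 0, IncompleteKloostermanBound K₀` (`K₀ = 2`).
[cite: ConreyIwaniec2002, §4 (4.14)] -/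
theorem incomplete_kloosterman : ∃ K₀ : ℝ, 0 < K₀ ∧ IncompleteKloostermanBound K₀ :=
  ⟨2, by norm_num, incompleteKloostermanBound_two⟩

end ConreyIwaniec2002

end Literature.NumberTheory.LFunctions

end
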